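import Summits.CriticalPhenomena.PercolationContinuityZ3.Theorems.PercNonProliferationSubpolynomialBlockingUniquenessDichotomy
import Summits.CriticalPhenomena.PercolationContinuityZ3.Theses.PercAnnulusCrossing
import HarnessLib

/-!
# Crux `PercNonProliferation.SubpolynomialBlocking` (stmt-CriticalPhenomena-4446) — the edge from the sibling crux
# `CritAnnulusNonCrossing` (stmt-0846) and from any EVENTUAL constant blocking bound, in the Theorems tree

Lead c6 (prover-line-stmt-CriticalPhenomena-4446-c6-0); lands `--supports 4446`. The calibration "`X_B ⟹ r4`" was so far only in the
crux workfile `Cruxes/SubpolynomialBlocking/Disproof.lean` (§5, `of_critAnnulusNonCrossing`); this file puts it, and the slightly more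
general eventual form, into `Theorems/` so that the ledger's implication graph between the items 0846, 1141, 4446 is complete on the
certified side: `0846 ⟹ 4446` (here), `0846 ⟹ 1141` (`cubeBlockingSeed_of_critAnnulusNonCrossing`, p124521), `1129 ∧ 1141 ⟹ 0846 ⟹ 4446`
(p121157), `4446 ⟹ anchor` = sub-polynomial 1141 (p85067), `1141 ⟹ anchor` (p122294). No new definitions.
-/

noncomputable section

namespace Summit.CriticalPhenomena.PercolationContinuityZ3.Theorems.SubpolynomialBlocking

open MeasureTheory Filter Topology
open Literature.Probability.Percolation Literature.Probability.LatticeModels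
open Literature.Barriers.CriticalPhenomena
open Summit.CriticalPhenomena.PercolationContinuityZ3.Theorems.SubpolynomialBlocking.Negative

/-- **An eventual constant lower bound on the critical blocking probability implies the crux** (registered as
`subpolynomialBlocking_of_eventually_le`): if `c ≤ u_n` for all large `n` (`c > 0`) then `SubpolynomialBlocking`, since `n^{-s} ≤ c`
eventually for every `s > 0`. [folklore] -/
theorem subpolynomialBlocking_of_eventually_le :
    (∃ c : ℝ, 0 < c ∧ ∀ᶠ n : ℕ in atTop,
        c ≤ (bondPercolation (zdGraph 3) (criticalProbI 3)).real (Literature.Barriers.CriticalPhenomena.annulusCrossing 3 n)ᶜ) →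
      Summit.CriticalPhenomena.PercolationContinuityZ3.Theses.PercNonProliferation.SubpolynomialBlocking := by
  rintro ⟨c, hc, hev⟩
  rw [crux_iff, subpolynomialBlockingAt_iff]
  intro s hs
  exact eventually_rpow_le_of_eventually_le hc hev s hs

/-- **`CritAnnulusNonCrossing ⟹ SubpolynomialBlocking` (stmt-0846 ⟹ stmt-4446; registered as
`subpolynomialBlocking_of_critAnnulusNonCrossing`)**: the constant form `P_{p_c}(cross_n) ≤ 1 - c` (`n ≥ 1`) gives `u_n = 1 - P_{p_c}(cross_n) ≥ c`
for all `n ≥ 1`, in particular eventually. (The Theorems-tree copy of `Disproof.of_critAnnulusNonCrossing`.) [folklore] -/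
theorem subpolynomialBlocking_of_critAnnulusNonCrossing :
    Summit.CriticalPhenomena.PercolationContinuityZ3.Theses.PercAnnulusCrossing.CritAnnulusNonCrossing →
      Summit.CriticalPhenomena.PercolationContinuityZ3.Theses.PercNonProliferation.SubpolynomialBlocking := by
  rintro ⟨c, hc, hcross⟩
  refine subpolynomialBlocking_of_eventually_le ⟨c, hc, ?_⟩
  filter_upwards [eventually_ge_atTop 1] with n hn
  have heq := blockProb_eq 3 (criticalProbI 3) n
  have h := hcross n hn
  change (bondPercolation (zdGraph 3) (criticalProbI 3)).real (annulusCrossing 3 n) ≤ 1 - c at h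
  change c ≤ blockProb 3 (criticalProbI 3) n
  linarith

end Summit.CriticalPhenomena.PercolationContinuityZ3.Theorems.SubpolynomialBlocking

end
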